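import Literature.Probability.LatticeModels.AnnealedDeviceCorr
import Literature.Probability.LatticeModels.IsingTransport
import Literature.Analysis.FunctionSpaces.ChordalNearest
import HarnessLib

/-!
# The device Gibbs average in labelled coordinates

Topic `Probability/LatticeModels`; companion of `AnnealedDeviceCorr.lean` (the annealed Ising
correlator of the S³ Poisson–Delaunay device of route
`CriticalPhenomena/Ising3DConformalLimit/ConformalPoissonDevice`, crux `DeviceWeylUniversality`,
stmt-CriticalPhenomena-4722, stub D2 `stub_deviceMeasurable` of its line `birth`).

The integrand `deviceGibbsAverage β n x ω` of `annealedDeviceCorr` lives on the vertex type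
`↥h.toFinset` of the (finite) configuration `ω` and reads spins at Hilbert-`ε` chordal-nearest sites,
so its measurability in `ω` is not visible. This file rewrites it, for a configuration with `k` points
LABELLED by `p : Fin k → F`, as a function of `p` on the fixed vertex type `Fin k`:

* `labelledPencilGraph p` — the pencil-rule graph on `Fin k` (`a ~ b` iff `IsMoebiusDelaunayPair
  (range p) (p a) (p b)`); `labelledReadout p y` — the labels of the chordal-nearest sites to `y`
  (the argmin PREDICATE `IsChordalNearest`, not Hilbert's `ε`); `labelledObservable`,
  `labelledGibbsAverage β n x p` — the free zero-field Gibbs average of the read-out spin product;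
* `labelledGibbsAverage_eq_deviceGibbsAverage` — **transport**: if `p` labels the finite configuration
  `ω` bijectively and the chordal-nearest site of each `xᵢ` is unique, the labelled Gibbs average IS
  `deviceGibbsAverage β n x ω` (free expectations only see the induced graph, tree
  `isingExpect_free_map`; Friedli–Velenik 2017, §3.1);
* `isClosed_setOf_isMoebiusDelaunayPair_labelled`, `isClosed_setOf_isChordalNearest_labelled`,
  `measurable_labelledGibbsAverage` — the pencil-pair event is CLOSED in `p` (the pencil parameters
  range over a compact sphere; closed projection `isClosedMap_snd_of_compactSpace`), the argmin event is
  closed, hence `p ↦ labelledGibbsAverage β n x p` is Borel measurable (it factors through the finite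
  set of (graph, read-out) data).

Deliberately NOT here: the passage from labelled tuples back to configurations (factorial measures)
and the a.e. statement under a Poisson law (file `AnnealedDeviceCorrMeasurable`).
-/

noncomputable section

open scoped Classical
open MeasureTheory Set Function
open Literature.Analysis.FunctionSpaces

namespace Literature.Probability.LatticeModels

/-! ### Labelled read-out and observable (normed groups) -/

section Readout

variable {F : Type*} [NormedAddCommGroup F] {k : ℕ}

/-- The **labelled read-out**: the labels `a` whose point `p a` is a chordal-nearest point of `range p`
to `y` (the argmin predicate `IsChordalNearest`; a singleton when the minimiser is unique). [folklore] -/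
def labelledReadout (p : Fin k → F) (y : F) : Finset (Fin k) :=
  Finset.univ.filter fun a => IsChordalNearest (Set.range p) y (p a)

/-- Membership in the labelled read-out. [folklore] -/
theorem mem_labelledReadout {p : Fin k → F} {y : F} {a : Fin k} :
    a ∈ labelledReadout p y ↔ IsChordalNearest (Set.range p) y (p a) := by
  simp [labelledReadout]

/-- The **labelled device observable** `σ ↦ ∏ᵢ ∏_{a ∈ read-out of xᵢ} σ_a` on `SpinConfig (Fin k)`.
[folklore] -/
def labelledObservable (p : Fin k → F) (n : ℕ) (x : Fin n → F) (σ : SpinConfig (Fin k)) : ℝ :=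
  ∏ i, ∏ a ∈ labelledReadout p (x i), spinAt a σ

/-- `|∏ ∏ σ_a| = 1`. [folklore] -/
theorem abs_labelledObservable (p : Fin k → F) (n : ℕ) (x : Fin n → F) (σ : SpinConfig (Fin k)) :
    |labelledObservable p n x σ| = 1 := by
  simp [labelledObservable, Finset.abs_prod, abs_spinAt]

/-- The labelled observable is measurable (a finite product of coordinate spins). [folklore] -/
theorem measurable_labelledObservable (p : Fin k → F) (n : ℕ) (x : Fin n → F) :
    Measurable (labelledObservable p n x) :=
  measurable_of_countable _

/-- Under uniqueness of the minimiser, the Hilbert-`ε` read-out `chordalNearest ω y` is characterised by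
the argmin predicate: `q = chordalNearest ω y ↔ IsChordalNearest ω y q` (finite non-empty `ω`).
[folklore] -/
theorem eq_chordalNearest_iff {ω : Set F} (hω : ω.Finite) (hne : ω.Nonempty) {y q : F}
    (hsub : {q | IsChordalNearest ω y q}.Subsingleton) :
    q = chordalNearest ω y ↔ IsChordalNearest ω y q := by
  have hspec : IsChordalNearest ω y (chordalNearest ω y) :=
    Literature.Analysis.FunctionSpaces.chordalNearest_spec (exists_isChordalNearest hω hne y)
  exact ⟨fun h => h ▸ hspec, fun h => hsub h hspec⟩

end Readout

/-! ### Labelled pencil graph and Gibbs average (inner product spaces) -/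

section Labelled

variable {F : Type*} [NormedAddCommGroup F] [InnerProductSpace ℝ F] {k : ℕ}

/-- The **labelled pencil-rule graph** on `Fin k` of a labelled configuration `p : Fin k → F`:
distinct labels `a, b` are adjacent iff `p a, p b` satisfy the pencil rule `IsMoebiusDelaunayPair` with
respect to `range p` (Boissonnat–Yvinec 1998, §17.2, completed projectively; `SimpleGraph.fromRel` as in
`devicePencilGraph`). [folklore] -/
abbrev labelledPencilGraph (p : Fin k → F) : SimpleGraph (Fin k) :=
  SimpleGraph.fromRel fun a b => IsMoebiusDelaunayPair (Set.range p) (p a) (p b)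

/-- Adjacency in the labelled pencil graph. [folklore] -/
theorem labelledPencilGraph_adj (p : Fin k → F) {a b : Fin k} :
    (labelledPencilGraph p).Adj a b ↔ a ≠ b ∧ IsMoebiusDelaunayPair (Set.range p) (p a) (p b) := by
  rw [SimpleGraph.fromRel_adj]
  exact ⟨fun ⟨hne, h'⟩ => ⟨hne, h'.elim id IsMoebiusDelaunayPair.symm⟩,
    fun ⟨hne, h'⟩ => ⟨hne, Or.inl h'⟩⟩

/-- The uniform `LocallyFinite` structure on a graph with finitely many vertices (`Fintype.ofFinite`,
independent of any decidability of the adjacency), used so that the Gibbs average depends on the graph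
through ONE instance path. [folklore] -/
abbrev locallyFiniteOfFin (H : SimpleGraph (Fin k)) : H.LocallyFinite := fun _ => Fintype.ofFinite _

/-- The **free zero-field Gibbs average of a read-out spin product as a function of the finite data**
`(H, R)` = (graph on `Fin k`, read-out label sets): `⟨∏ᵢ ∏_{a ∈ R i} σ_a⟩^∅_{univ;β,0}` on `H`
(Friedli–Velenik 2017, §3.1). [cite: FriedliVelenik2017, §3.1] -/
def gibbsOfData (β : ℝ) {n : ℕ} (t : SimpleGraph (Fin k) × (Fin n → Finset (Fin k))) : ℝ :=
  @isingExpect (Fin k) t.1 _ (locallyFiniteOfFin t.1) Finset.univ β 0 BoundaryCondition.free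
    fun σ => ∏ i, ∏ a ∈ t.2 i, spinAt a σ

/-- The **labelled device Gibbs average** `⟨∏ᵢ ∏_{a ∈ read-out of xᵢ} σ_a⟩^∅_{univ;β,0}` on the
labelled pencil graph (free boundary condition, zero field, whole vertex set `Fin k`): `gibbsOfData` of
the labelled (graph, read-out) data. [cite: FriedliVelenik2017, §3.1] -/
def labelledGibbsAverage (β : ℝ) (n : ℕ) (x : Fin n → F) (p : Fin k → F) : ℝ :=
  gibbsOfData β (labelledPencilGraph p, fun i => labelledReadout p (x i))

/-- Unfolding: the labelled Gibbs average is the free expectation of `labelledObservable` on the labelled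
pencil graph, for the uniform `LocallyFinite` structure. [folklore] -/
theorem labelledGibbsAverage_eq (β : ℝ) (n : ℕ) (x : Fin n → F) (p : Fin k → F) :
    labelledGibbsAverage β n x p =
      @isingExpect (Fin k) (labelledPencilGraph p) _ (locallyFiniteOfFin (labelledPencilGraph p))
        Finset.univ β 0 BoundaryCondition.free (labelledObservable p n x) :=
  rfl

/-- `|labelledGibbsAverage| ≤ 1` (a `±1`-valued observable under a probability measure).
[cite: FriedliVelenik2017, §3.6.1] -/
theorem abs_labelledGibbsAverage_le_one (β : ℝ) (n : ℕ) (x : Fin n → F) (p : Fin k → F) :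
    |labelledGibbsAverage β n x p| ≤ 1 := by
  letI := locallyFiniteOfFin (labelledPencilGraph p)
  rw [labelledGibbsAverage_eq, isingExpect, ← Real.norm_eq_abs]
  calc _ ≤ 1 * (isingMeasure (labelledPencilGraph p) Finset.univ β 0 .free).real Set.univ :=
        norm_integral_le_of_norm_le_const (Filter.Eventually.of_forall fun σ => by
          rw [Real.norm_eq_abs, abs_labelledObservable])
    _ = 1 := by rw [probReal_univ, mul_one]

end Labelled

/-! ### Transport: the labelled Gibbs average of a bijective labelling is the device Gibbs average -/

section Transport

variable {d k : ℕ}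

local notation "𝔼" => EuclideanSpace ℝ (Fin d)

/-- **Transport to the device.** Let `ω` be a finite non-empty configuration, `e : Fin k ≃ ↥h.toFinset`
a bijective labelling and `p a = e a`. If the chordal-nearest site of each `xᵢ` is unique, the labelled
Gibbs average equals the quenched device Gibbs average
`⟨∏ᵢ σ_{chordalNearest ω xᵢ}⟩^∅_{univ;β,0}` on `devicePencilGraph ω h`: the labelling is a graph
isomorphism (same pencil rule, `range p = ω`) and free expectations only depend on the induced graph
(tree `isingExpect_free_map`; Friedli–Velenik 2017, §3.1, Def. 3.1 with eq. (3.2)).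
[cite: FriedliVelenik2017, §3.1, Def. 3.1] -/
theorem labelledGibbsAverage_eq_isingExpect {ω : Set 𝔼} (h : ω.Finite) (hne : ω.Nonempty)
    (e : Fin k ≃ ↥h.toFinset) (β : ℝ) (n : ℕ) (x : Fin n → 𝔼)
    (hsub : ∀ i, {q | IsChordalNearest ω (x i) q}.Subsingleton) :
    labelledGibbsAverage β n x (fun a => (e a : 𝔼)) =
      isingExpect (devicePencilGraph ω h) Finset.univ β 0 BoundaryCondition.free
        (deviceObservable ω h n x) := by
  set p : Fin k → 𝔼 := fun a => (e a : 𝔼) with hp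
  have hrange : Set.range p = ω := by
    ext z
    constructor
    · rintro ⟨a, rfl⟩
      exact h.mem_toFinset.1 (e a).2
    · intro hz
      obtain ⟨a, ha⟩ := e.surjective ⟨z, h.mem_toFinset.2 hz⟩
      exact ⟨a, by rw [hp]; simp only; rw [ha]⟩
  -- the labelling is a graph isomorphism onto the device graph
  have hadj : ∀ a ∈ (Finset.univ : Finset (Fin k)), ∀ b ∈ (Finset.univ : Finset (Fin k)),
      ((devicePencilGraph ω h).Adj (e.toEmbedding a) (e.toEmbedding b) ↔
        (labelledPencilGraph p).Adj a b) := by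
    intro a _ b _
    rw [devicePencilGraph_adj, labelledPencilGraph_adj, hrange]
    simp only [Equiv.coe_toEmbedding, ne_eq, EmbeddingLike.apply_eq_iff_eq]
    rfl
  have hmap : (Finset.univ : Finset (Fin k)).map e.toEmbedding = Finset.univ :=
    Finset.map_univ_equiv e
  letI := locallyFiniteOfFin (labelledPencilGraph p)
  have key := isingExpect_free_map (G := labelledPencilGraph p) (G' := devicePencilGraph ω h)
    e.toEmbedding (Λ := Finset.univ) hadj β 0 (measurable_of_countable (deviceObservable ω h n x))
  rw [hmap] at key
  rw [key, labelledGibbsAverage_eq]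
  congr 1
  funext σ
  -- the pulled-back device observable is the labelled observable
  unfold deviceObservable labelledObservable
  refine Finset.prod_congr rfl fun i _ => ?_
  -- the device read-out filter is the image of the labelled read-out under `e`
  have hset : (Finset.univ.filter fun v : ↥h.toFinset => (v : 𝔼) = chordalNearest ω (x i)) =
      (labelledReadout p (x i)).map e.toEmbedding := by
    ext v
    simp only [Finset.mem_filter, Finset.mem_univ, true_and, Finset.mem_map, Equiv.coe_toEmbedding]
    constructor
    · intro hv
      refine ⟨e.symm v, ?_, e.apply_symm_apply v⟩
      rw [mem_labelledReadout, hrange]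
      have : (v : 𝔼) = p (e.symm v) := by rw [hp]; simp
      rw [← this]
      exact (eq_chordalNearest_iff h hne (hsub i)).1 hv
    · rintro ⟨a, ha, rfl⟩
      rw [mem_labelledReadout, hrange] at ha
      exact (eq_chordalNearest_iff h hne (hsub i)).2 ha
  rw [hset, Finset.prod_map]
  exact Finset.prod_congr rfl fun a _ => (spinAt_extendAlong e.toEmbedding σ a).symm

/-- **Transport to `deviceGibbsAverage`** (configurations `ω : PointConfig F`): for a finite non-empty
configuration labelled bijectively by `e`, with unique chordal-nearest sites, the labelled Gibbs average
is `deviceGibbsAverage β n x ω`. [cite: FriedliVelenik2017, §3.1, Def. 3.1] -/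
theorem labelledGibbsAverage_eq_deviceGibbsAverage {ω : PointConfig 𝔼} (h : (ω : Set 𝔼).Finite)
    (hne : (ω : Set 𝔼).Nonempty) (e : Fin k ≃ ↥h.toFinset) (β : ℝ) (n : ℕ) (x : Fin n → 𝔼)
    (hsub : ∀ i, {q | IsChordalNearest (ω : Set 𝔼) (x i) q}.Subsingleton) :
    labelledGibbsAverage β n x (fun a => (e a : 𝔼)) = deviceGibbsAverage β n x ω := by
  rw [deviceGibbsAverage, dif_pos h]
  exact labelledGibbsAverage_eq_isingExpect h hne e β n x hsub

end Transport

/-! ### Closedness of the pencil-pair and argmin events; measurability of the labelled average -/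

section Measurability

variable {F : Type*} [NormedAddCommGroup F] [InnerProductSpace ℝ F] {k : ℕ}

/-- The pencil form `Q_θ(z) = a‖z‖² + ⟪b, z⟫ + c` with parameter `θ = (a, b, c)`. [folklore] -/
def pencilForm (θ : ℝ × F × ℝ) (z : F) : ℝ := θ.1 * ‖z‖ ^ 2 + inner ℝ θ.2.1 z + θ.2.2

/-- The pencil form is jointly continuous in `(θ, z)`. [folklore] -/
theorem continuous_pencilForm : Continuous fun r : (ℝ × F × ℝ) × F => pencilForm r.1 r.2 := by
  unfold pencilForm
  fun_prop

/-- Positive homogeneity of the pencil form in the parameter. [folklore] -/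
theorem pencilForm_smul (t : ℝ) (θ : ℝ × F × ℝ) (z : F) :
    pencilForm (t • θ) z = t * pencilForm θ z := by
  simp only [pencilForm, Prod.smul_fst, Prod.smul_snd, smul_eq_mul, real_inner_smul_left]
  ring

/-- The pencil rule with parameters normalised to the unit sphere: `IsMoebiusDelaunayPair ω p q` iff some
`θ` with `‖θ‖ = 1` has `Q_θ(p) = Q_θ(q) = 0` and `Q_θ ≥ 0` on `ω` (the conditions are positively
homogeneous in `θ`). [folklore] -/
theorem isMoebiusDelaunayPair_iff_exists_mem_sphere {ω : Set F} {p q : F} :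
    IsMoebiusDelaunayPair ω p q ↔ ∃ θ ∈ Metric.sphere (0 : ℝ × F × ℝ) 1,
      pencilForm θ p = 0 ∧ pencilForm θ q = 0 ∧ ∀ z ∈ ω, 0 ≤ pencilForm θ z := by
  constructor
  · rintro ⟨a, c, b, hne, hp, hq, hω⟩
    set θ : ℝ × F × ℝ := (a, b, c) with hθ
    have hθ0 : θ ≠ 0 := by
      intro h0
      simp only [hθ, Prod.mk_eq_zero] at h0
      rcases hne with h | h | h
      · exact h h0.1
      · exact h h0.2.1
      · exact h h0.2.2
    have ht : 0 < ‖θ‖ := norm_pos_iff.2 hθ0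
    refine ⟨‖θ‖⁻¹ • θ, by simp [norm_smul, inv_mul_cancel₀ ht.ne'], ?_, ?_, fun z hz => ?_⟩
    · rw [pencilForm_smul, show pencilForm θ p = 0 from hp, mul_zero]
    · rw [pencilForm_smul, show pencilForm θ q = 0 from hq, mul_zero]
    · rw [pencilForm_smul]
      exact mul_nonneg (inv_nonneg.2 ht.le) (hω z hz)
  · rintro ⟨θ, hθ, hp, hq, hω⟩
    have hθ0 : θ ≠ 0 := by
      rintro rfl
      simp at hθ
    refine ⟨θ.1, θ.2.2, θ.2.1, ?_, hp, hq, hω⟩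
    by_contra hall
    push Not at hall
    exact hθ0 (Prod.ext hall.1 (Prod.ext hall.2.1 hall.2.2))

variable [FiniteDimensional ℝ F]

/-- **The labelled pencil-pair event is closed**: `{p : Fin k → F | IsMoebiusDelaunayPair (range p)
(p a) (p b)}` is closed — it is the projection along the COMPACT unit sphere of parameters of the closed
set `{(θ, p) | Q_θ(p a) = Q_θ(p b) = 0, Q_θ(p j) ≥ 0 ∀ j}` (`isClosedMap_snd_of_compactSpace`).
[folklore] -/
theorem isClosed_setOf_isMoebiusDelaunayPair_labelled (a b : Fin k) :
    IsClosed {p : Fin k → F | IsMoebiusDelaunayPair (Set.range p) (p a) (p b)} := by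
  set S := Metric.sphere (0 : ℝ × F × ℝ) 1 with hS
  let Q : Fin k → ↥S × (Fin k → F) → ℝ := fun j r => pencilForm (r.1 : ℝ × F × ℝ) (r.2 j)
  have hQ : ∀ j : Fin k, Continuous (Q j) := fun j => continuous_pencilForm.comp
    ((continuous_subtype_val.comp continuous_fst).prodMk ((continuous_apply j).comp continuous_snd))
  set K : Set (↥S × (Fin k → F)) := {r | Q a r = 0} ∩ ({r | Q b r = 0} ∩ ⋂ j, {r | 0 ≤ Q j r})
    with hK
  have hKc : IsClosed K :=
    (isClosed_eq (hQ a) continuous_const).inter ((isClosed_eq (hQ b) continuous_const).inter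
      (isClosed_iInter fun j => isClosed_le continuous_const (hQ j)))
  have himage : Prod.snd '' K = {p : Fin k → F | IsMoebiusDelaunayPair (Set.range p) (p a) (p b)} := by
    ext p
    rw [Set.mem_setOf_eq, isMoebiusDelaunayPair_iff_exists_mem_sphere]
    constructor
    · rintro ⟨⟨⟨θ, hθ⟩, p'⟩, hKm, rfl⟩
      simp only [hK, Set.mem_inter_iff, Set.mem_setOf_eq, Set.mem_iInter] at hKm
      exact ⟨θ, hθ, hKm.1, hKm.2.1, fun z ⟨j, hj⟩ => hj ▸ hKm.2.2 j⟩
    · rintro ⟨θ, hθ, h1, h2, h3⟩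
      refine ⟨⟨⟨θ, hθ⟩, p⟩, ?_, rfl⟩
      simp only [hK, Set.mem_inter_iff, Set.mem_setOf_eq, Set.mem_iInter]
      exact ⟨h1, h2, fun j => h3 _ (Set.mem_range_self j)⟩
  rw [← himage]
  exact isClosedMap_snd_of_compactSpace K hKc

omit [InnerProductSpace ℝ F] [FiniteDimensional ℝ F] in
/-- **The labelled argmin event is closed**: `{p | IsChordalNearest (range p) y (p a)}` is the finite
intersection of the closed sets `{p | crit y (p a) ≤ crit y (p j)}`. [folklore] -/
theorem isClosed_setOf_isChordalNearest_labelled (y : F) (a : Fin k) :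
    IsClosed {p : Fin k → F | IsChordalNearest (Set.range p) y (p a)} := by
  have hc : ∀ j : Fin k, Continuous fun p : Fin k → F => chordalCriterion y (p j) := fun j =>
    continuous_chordalCriterion.comp (continuous_const.prodMk (continuous_apply j))
  have hset : {p : Fin k → F | IsChordalNearest (Set.range p) y (p a)} =
      ⋂ j, {p | chordalCriterion y (p a) ≤ chordalCriterion y (p j)} := by
    ext p
    simp only [Set.mem_setOf_eq, isChordalNearest_iff, Set.mem_range_self, Set.forall_mem_range,
      true_and, Set.mem_iInter]
  rw [hset]
  exact isClosed_iInter fun j => isClosed_le (hc a) (hc j)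

/-- A set of the form `{p | A p ↔ B}` with `{p | A p}` measurable is measurable. [folklore] -/
theorem measurableSet_setOf_iff {α : Type*} [MeasurableSpace α] {A : α → Prop} {B : Prop}
    (hA : MeasurableSet {p | A p}) : MeasurableSet {p | A p ↔ B} := by
  by_cases hB : B
  · have : {p | A p ↔ B} = {p | A p} := by ext p; simp [hB]
    rwa [this]
  · have : {p | A p ↔ B} = {p | A p}ᶜ := by ext p; simp [hB]
    rw [this]
    exact hA.compl

variable [MeasurableSpace F] [BorelSpace F] [SecondCountableTopology F]

/-- The level sets of the labelled pencil graph are measurable. [folklore] -/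
theorem measurableSet_labelledPencilGraph_eq (H : SimpleGraph (Fin k)) :
    MeasurableSet {p : Fin k → F | labelledPencilGraph p = H} := by
  have hset : {p : Fin k → F | labelledPencilGraph p = H} =
      ⋂ a, ⋂ b, {p | (labelledPencilGraph p).Adj a b ↔ H.Adj a b} := by
    ext p
    simp only [Set.mem_setOf_eq, Set.mem_iInter]
    exact ⟨fun h a b => h ▸ Iff.rfl,
      fun h => SimpleGraph.adj_inj.1 (funext fun a => funext fun b => propext (h a b))⟩
  rw [hset]
  refine MeasurableSet.iInter fun a => MeasurableSet.iInter fun b => measurableSet_setOf_iff ?_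
  have hadj : {p : Fin k → F | (labelledPencilGraph p).Adj a b} =
      {_p | a ≠ b} ∩ {p | IsMoebiusDelaunayPair (Set.range p) (p a) (p b)} := by
    ext p
    simp only [Set.mem_setOf_eq, labelledPencilGraph_adj, Set.mem_inter_iff]
  rw [hadj]
  exact (MeasurableSet.const _).inter (isClosed_setOf_isMoebiusDelaunayPair_labelled a b).measurableSet

omit [InnerProductSpace ℝ F] [FiniteDimensional ℝ F] in
/-- The level sets of the labelled read-out are measurable. [folklore] -/
theorem measurableSet_labelledReadout_eq (y : F) (R : Finset (Fin k)) :
    MeasurableSet {p : Fin k → F | labelledReadout p y = R} := by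
  have hset : {p : Fin k → F | labelledReadout p y = R} =
      ⋂ a, {p | IsChordalNearest (Set.range p) y (p a) ↔ a ∈ R} := by
    ext p
    simp only [Set.mem_setOf_eq, Set.mem_iInter, Finset.ext_iff, mem_labelledReadout]
  rw [hset]
  exact MeasurableSet.iInter fun a =>
    measurableSet_setOf_iff (isClosed_setOf_isChordalNearest_labelled y a).measurableSet

/-- **The labelled Gibbs average is Borel measurable in the labelled configuration**: it factors
through the finitely many (graph, read-out) data (`gibbsOfData`), whose level sets are measurable
(`measurableSet_labelledPencilGraph_eq`, `measurableSet_labelledReadout_eq`). [folklore] -/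
theorem measurable_labelledGibbsAverage (β : ℝ) (n : ℕ) (x : Fin n → F) :
    Measurable fun p : Fin k → F => labelledGibbsAverage β n x p := by
  letI : MeasurableSpace (SimpleGraph (Fin k) × (Fin n → Finset (Fin k))) := ⊤
  have hD : Measurable fun p : Fin k → F =>
      ((labelledPencilGraph p, fun i => labelledReadout p (x i)) :
        SimpleGraph (Fin k) × (Fin n → Finset (Fin k))) := by
    refine measurable_to_countable' fun t => ?_
    have hpre : (fun p : Fin k → F => ((labelledPencilGraph p, fun i => labelledReadout p (x i)) :
        SimpleGraph (Fin k) × (Fin n → Finset (Fin k)))) ⁻¹' {t} =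
        {p | labelledPencilGraph p = t.1} ∩ ⋂ i, {p | labelledReadout p (x i) = t.2 i} := by
      ext p
      simp only [Set.mem_preimage, Set.mem_singleton_iff, Prod.ext_iff, funext_iff, Set.mem_inter_iff,
        Set.mem_setOf_eq, Set.mem_iInter]
    rw [hpre]
    exact (measurableSet_labelledPencilGraph_eq t.1).inter
      (MeasurableSet.iInter fun i => measurableSet_labelledReadout_eq (x i) (t.2 i))
  exact (measurable_from_top (f := fun t => gibbsOfData β t)).comp hD

end Measurability

end Literature.Probability.LatticeModels

end
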